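import Summits.ResolutionOfSingularities.ResolutionOfSingularities.Theorems.FrobeniusLadderFInjectiveMacaulayficationFullNoKangaroo
import HarnessLib

/-!
# K4 — THE FULL BUDGET IS A WEIGHT (LOG-CANONICITY) BUDGET: a Fedder survivor bounds EVERY weighted order by the sum of the weights

[OURS · L1 W4.5a · res-L1-w45a-lead-1 g14 · kernel brick K4 for crux `FInjectiveMacaulayfication` stmt-ResolutionOfSingularities-15315,
companion of the pricing memo `Cruxes/FInjectiveMacaulayfication/Lines/T-cap-regime.md` §2 (B1); supports the crux, proves nothing of it;
OURS counted 0; AI-written (AI review is weaker than expert review).]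

THE STATEMENT (★ `le_sum_weights_of_survivor`). Let `φ ∈ A[y₁,…,y_m]` (any commutative ring `A`), `p ≥ 2`, and `w : Fin m → ℕ` a weight
vector. If every monomial of `φ` has `w`-weight `≥ n` (i.e. the `w`-weighted order of `φ` is `≥ n`) and `φ^{p−1} ∉ (y₁^p, …, y_m^p)` (a Fedder
SURVIVOR exists — for a hypersurface `{φ = 0}` in a regular ambient this is F-purity = FULL at the origin, [Fedder1983, Thm. 1.12]), then
`n ≤ w₁ + ⋯ + w_m`.
In valuative words: FULL at `x` ⇒ `v_w(φ) ≤ v_w(y₁⋯y_m) = A(v_w)` for the monomial valuation `v_w` of EVERY weight in EVERY regular system of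
parameters (the Frobenius power `𝔪^{[p]}` is coordinate-free) — the toric shadow of «F-pure ⇒ log canonical» [HaraWatanabe2002, Thm. 3.3]. The
unweighted case `w = (1,…,1)` is ✓p710092 `FullNoKangaroo.exists_degree_le_of_survivor` (the ORDER CAP `ord φ ≤ m`).

COROLLARIES (the level table of `T-cap-regime.md` §2 in kernel form).
* ★ `slope_budget`: in `m + 1` letters `x = X 0`, `y = X ∘ succ` with weights `(r; s, …, s)`: if every monomial of `f` has weight `≥ d·r`
  (the Weierstrass shape `f = x^d + Σ_{i ≥ 2} aᵢ(y) x^{d−i}` with `ord aᵢ ≥ i·r/s`, i.e. first slope `ν ≥ r/s`) and `f` is FULL, then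
  `d·r ≤ r + m·s`, i.e. `(d − 1)·ν ≤ m`: for 4-fold hypersurface germs (`m = 4`) `ν ≤ 4/(d−1)` — the desk's OC-2 bound (res-L1-w45a-plan-1 R24.6 (c)).
* ★ `order_le_two_mul_of_survivor` (double points): if `f = x² + a(y)` with `ord a ≥ o` is FULL then `o ≤ 2m`; for `m = 4`: the LEVEL-2
  ORDER of a FULL 4-fold double point is `≤ 8`, so a purely inseparable level-2 initial form (`ord a ≥ p`, `in(a)` a `p`-th power — «wild level 2»,
  no derivative maximal contact) can occur at a FULL double point only for `p ≤ 8`, i.e. `p ∈ {5, 7}` among `p ≥ 5` (beds `W♯₅`, `W♯₇` of the memo).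
No named fact is used; everything is exponent bookkeeping over an arbitrary commutative ring.
-/

-- single-problem summit: the doubled namespace component is forced
set_option linter.dupNamespace false

noncomputable section

open MvPolynomial Finsupp

namespace Summit.ResolutionOfSingularities.ResolutionOfSingularities.Theorems.FInjectiveMacaulayfication.FullWeightBudget

variable {A : Type} [CommRing A] {m : ℕ}

/-- The weight of an exponent vector on `Fin m` is the finite sum `Σᵢ dᵢ·wᵢ`. [plumbing] -/
theorem weight_eq_sum (w : Fin m → ℕ) (d : Fin m →₀ ℕ) : weight w d = ∑ i, d i * w i := by
  rw [weight_apply, Finsupp.sum_fintype]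
  · rfl
  · intro i
    simp

/-- Every monomial of `g^j` has `w`-weight `≥ j·n` when every monomial of `g` has `w`-weight `≥ n` (weighted order is super-additive).
Weighted twin of `FullNoKangaroo.le_degree_of_mem_support_pow`. [plumbing] -/
theorem le_weight_of_mem_support_pow (w : Fin m → ℕ) (g : MvPolynomial (Fin m) A) (n : ℕ)
    (hn : ∀ d ∈ g.support, n ≤ weight w d) :
    ∀ j : ℕ, ∀ e ∈ (g ^ j).support, j * n ≤ weight w e := by
  intro j
  induction j with
  | zero => intro e _; simp
  | succ j ih =>
    intro e he
    rw [pow_succ] at he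
    obtain ⟨a, ha, b, hb, rfl⟩ := Finset.mem_add.mp (support_mul _ _ he)
    rw [map_add, Nat.succ_mul]
    exact add_le_add (ih a ha) (hn b hb)

/-- A survivor exponent vector (`dᵢ ≤ p − 1` for all `i`) has `w`-weight `≤ (p−1)·Σ wᵢ`. [plumbing] -/
theorem weight_le_of_forall_lt (w : Fin m → ℕ) (p : ℕ) (d : Fin m →₀ ℕ) (hd : ∀ i, d i < p) :
    weight w d ≤ (p - 1) * ∑ i, w i := by
  rw [weight_eq_sum, Finset.mul_sum]
  exact Finset.sum_le_sum fun i _ => Nat.mul_le_mul_right _ (Nat.le_sub_one_of_lt (hd i))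

/-- ★ **THE FULL BUDGET.** If `φ^{p−1} ∉ (y₁^p, …, y_m^p)` (`p ≥ 2`) and every monomial of `φ` has `w`-weight `≥ n`, then `n ≤ Σᵢ wᵢ`:
a Fedder survivor bounds every weighted order of `φ` by the weight of `y₁⋯y_m` (the log discrepancy of the monomial valuation). With
`w = (1,…,1)` this is the order cap `exists_degree_le_of_survivor` (✓p710092). [OURS; cite: Fedder1983, Thm. 1.12 (context); HaraWatanabe2002, Thm. 3.3 (context:
F-pure ⇒ log canonical)] -/
theorem le_sum_weights_of_survivor (p : ℕ) (hp : 2 ≤ p) (w : Fin m → ℕ) (φ : MvPolynomial (Fin m) A) (n : ℕ)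
    (hn : ∀ d ∈ φ.support, n ≤ weight w d)
    (hF : φ ^ (p - 1) ∉ Ideal.span (Set.range fun i : Fin m => (X i : MvPolynomial (Fin m) A) ^ p)) :
    n ≤ ∑ i, w i := by
  obtain ⟨d, hd, hdp⟩ := FullNoKangaroo.exists_support_lt_of_not_mem p _ hF
  have hlow : (p - 1) * n ≤ weight w d := le_weight_of_mem_support_pow w φ n hn (p - 1) d hd
  have hhigh : weight w d ≤ (p - 1) * ∑ i, w i := weight_le_of_forall_lt w p d hdp
  exact Nat.le_of_mul_le_mul_left (hlow.trans hhigh) (by omega)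

/-- `Σᵢ (r; s,…,s)ᵢ = r + m·s` for the weight vector `(r; s,…,s) = Fin.cons r (s,…,s)` on `Fin (m+1)` (weight `r` on the contact letter `X 0`,
weight `s` on the `m` other letters). [plumbing] -/
theorem sum_cons_const (r s : ℕ) : ∑ i, (Fin.cons r (fun _ : Fin m => s) : Fin (m + 1) → ℕ) i = r + m * s := by
  rw [Fin.sum_univ_succ]
  simp

/-- ★ **SLOPE BUDGET** (`T-cap-regime.md` §2 (B2), desk OC-2). In letters `x = X 0`, `y₁…y_m`, with weights `(r; s,…,s)`: if every monomial of `f`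
has weight `≥ d·r` (e.g. `f = x^d + Σ_{i≥2} aᵢ(y)x^{d−i}` with `s·ord aᵢ ≥ i·r`, first slope `ν ≥ r/s`) and `f^{p−1} ∉ (x^p, yᵢ^p)` (FULL), then
`d·r ≤ r + m·s` — i.e. `(d−1)·ν ≤ m`; for 4-fold hypersurface germs `ν ≤ 4/(d−1)` (d = 5 ⇒ ν = 1; d = 2 ⇒ ord a₂ ≤ 8). [OURS] -/
theorem slope_budget (p : ℕ) (hp : 2 ≤ p) (r s d : ℕ) (f : MvPolynomial (Fin (m + 1)) A)
    (hn : ∀ e ∈ f.support, d * r ≤ weight (Fin.cons r (fun _ : Fin m => s) : Fin (m + 1) → ℕ) e)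
    (hF : f ^ (p - 1) ∉ Ideal.span (Set.range fun i : Fin (m + 1) => (X i : MvPolynomial (Fin (m + 1)) A) ^ p)) :
    d * r ≤ r + m * s := by
  rw [← sum_cons_const]
  exact le_sum_weights_of_survivor p hp _ f (d * r) hn hF

/-- `rename Fin.succ` turns `(r; s,…,s)`-weights into constant `s`-weights: `weight (r; s^m) (mapDomain succ d) = s·|d|`. [plumbing] -/
theorem weight_cons_mapDomain_succ (r s : ℕ) (d : Fin m →₀ ℕ) :
    weight (Fin.cons r (fun _ : Fin m => s) : Fin (m + 1) → ℕ) (Finsupp.mapDomain Fin.succ d) = s * degree d := by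
  classical
  rw [weight_apply, Finsupp.sum_mapDomain_index_inj (Fin.succ_injective m), degree_eq_weight_one, weight_apply,
    Finsupp.sum, Finsupp.sum, Finset.mul_sum]
  refine Finset.sum_congr rfl fun i _ => ?_
  simp [mul_comm]

/-- ★ **DOUBLE-POINT BUDGET** (`T-cap-regime.md` §2: level-2 order of a FULL double point). If `f = x² + a(y₁,…,y_m)` with every monomial of `a`
of degree `≥ o` (`ord a ≥ o`) and `f^{p−1} ∉ (x^p, y₁^p, …, y_m^p)` (`p ≥ 2`), then `o ≤ 2m`. For `m = 4`: `ord a ≤ 8`, so a «wild» level-2 datum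
(`ord a ≥ p` with `p`-th-power initial form, no derivative maximal contact) at a FULL 4-fold double point forces `p ≤ 8`. [OURS] -/
theorem order_le_two_mul_of_survivor (p : ℕ) (hp : 2 ≤ p) (o : ℕ) (a : MvPolynomial (Fin m) A)
    (ha : ∀ d ∈ a.support, o ≤ degree d) (f : MvPolynomial (Fin (m + 1)) A) (hf : f = X 0 ^ 2 + rename Fin.succ a)
    (hF : f ^ (p - 1) ∉ Ideal.span (Set.range fun i : Fin (m + 1) => (X i : MvPolynomial (Fin (m + 1)) A) ^ p)) :
    o ≤ 2 * m := by
  classical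
  have key : 2 * o ≤ o + m * 2 := by
    refine slope_budget p hp o 2 2 f ?_ hF
    intro e he
    rw [hf] at he
    rcases Finset.mem_union.mp (MvPolynomial.support_add he) with h1 | h2
    · -- the monomial `x²`: weight `2·o`
      have hc : coeff e ((X (0 : Fin (m + 1)) : MvPolynomial (Fin (m + 1)) A) ^ 2) ≠ 0 := MvPolynomial.mem_support_iff.mp h1
      rw [coeff_X_pow] at hc
      split_ifs at hc with h
      · rw [← h, weight_single, Fin.cons_zero, smul_eq_mul]
      · exact absurd rfl hc
    · -- a monomial of `a(y)`: weight `2·deg ≥ 2·o`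
      obtain ⟨u, rfl, hu⟩ := coeff_rename_ne_zero _ _ _ (MvPolynomial.mem_support_iff.mp h2)
      rw [weight_cons_mapDomain_succ]
      have := ha u (MvPolynomial.mem_support_iff.mpr hu)
      omega
  omega

end Summit.ResolutionOfSingularities.ResolutionOfSingularities.Theorems.FInjectiveMacaulayfication.FullWeightBudget

end
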